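import Mathlib
import Literature.Probability.MarkovChains.TotalVariation
import Summits.Ventures.LatticeQCDFlow.Exactness.FlowMCMC
import Summits.Ventures.LatticeQCDFlow.Scaling.ImportanceWeights

/-!
# LatticeQCDFlow / Scaling — the ACCEPTANCE side of the volume law: Bhattacharyya / Le Cam (T2-M)

HONEST FRAMING: exact (Metropolis-corrected) sampling algorithms for lattice gauge theory;
figures of merit are autocorrelation/cost numbers at stated couplings and volumes; no
continuum-physics claim.

Venture `LatticeQCDFlow` (cell pub-lqcd), topic `Scaling`, item T2-M/T2-M′ of HOME/THEORY-2.md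
§4 (fourth conjunct of barrier B1 `VolumeScalingOfTraining`), landed by FANOUT row 31 from
`HOME/THEORY-2-Sketch.lean` (theory seat; v1.2 proofs, decls verbatim).  `accRate p q` (mean
Metropolis acceptance of the flow proposal at stationarity) is row 30's
`Exactness/FlowMCMC.lean`; `blockProd` is `Scaling/ImportanceWeights.lean`; `tvDist` the tree's.

* `bhatt p q = Σ √(p q)` (Bhattacharyya coefficient); `accRate_le_bhatt_sq` — `acc ≤ BC²`
  (`min(a,b) ≤ √(ab)` termwise, then Cauchy–Schwarz);
* `bhatt_sq_le` — Le Cam: `BC² ≤ 1 − TV²`; hence `accRate_le_one_sub_tvDist_sq`;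
* `bhatt_blockProd` — tensorisation `BC(⊗pᵢ, ⊗qᵢ) = ∏ BC(pᵢ, qᵢ)`;
* `acc_blockDefect_volume_law` / `AccBlockDefectVolumeLaw` / `accBlockDefectVolumeLaw` (T2-M′) —
  in the factorised regime, per-block total-variation defect `≥ δ` on `m` blocks forces
  `acc ≤ (1 − δ²)^m ≤ exp(−m δ²)`: the acceptance rate of the exact chain decays exponentially
  in the number of blocks (volume at fixed block size), the theorem form of the printed
  acceptance-vs-volume laws (Finkenrath 2022; Abbott et al. 2022) in the factorised MODEL.
-/

namespace Summit.Ventures.LatticeQCDFlow.Theory2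

open Finset Literature.Probability.MarkovChains
open Summit.Ventures.LatticeQCDFlow.Exactness

section AccV12

variable {X : Type*} [Fintype X]

/-- Bhattacharyya coefficient (Hellinger affinity) of two finite weight functions. [folklore] -/
noncomputable def bhatt (p q : X → ℝ) : ℝ := ∑ x, Real.sqrt (p x * q x)

/-- The Bhattacharyya coefficient is non-negative. [folklore] -/
theorem bhatt_nonneg (p q : X → ℝ) : 0 ≤ bhatt p q :=
  sum_nonneg fun _ _ => Real.sqrt_nonneg _

/-- `min a b ≤ √(a b)` for `a, b ≥ 0`. [folklore] (private helper; the same one-liner exists elsewhere in the tree) -/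
private theorem min_le_sqrt_mul {a b : ℝ} (ha : 0 ≤ a) (hb : 0 ≤ b) : min a b ≤ Real.sqrt (a * b) := by
  have hmin : 0 ≤ min a b := le_min ha hb
  have hsq : min a b ^ 2 ≤ a * b := by
    rcases le_total a b with h | h
    · rw [min_eq_left h, sq]; exact mul_le_mul_of_nonneg_left h ha
    · rw [min_eq_right h, sq, mul_comm]; exact mul_le_mul_of_nonneg_right h hb
  calc min a b = Real.sqrt (min a b ^ 2) := (Real.sqrt_sq hmin).symm
    _ ≤ Real.sqrt (a * b) := Real.sqrt_le_sqrt hsq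

/-- **T2-M (acceptance ≤ squared Bhattacharyya coefficient; proved).**  The stationary acceptance
rate of the independence sampler, `acc = Σ_{x,y} min(p_x q_y, p_y q_x)`, is at most
`(Σ_x √(p_x q_x))² = BC(p,q)²`, termwise by `min(u,v) ≤ √(uv)`. [folklore] -/
theorem accRate_le_bhatt_sq {p q : X → ℝ} (hp : ∀ x, 0 ≤ p x) (hq : ∀ x, 0 ≤ q x) :
    accRate p q ≤ bhatt p q ^ 2 := by
  unfold accRate bhatt
  rw [sq, Finset.sum_mul_sum]
  refine Finset.sum_le_sum fun x _ => Finset.sum_le_sum fun y _ => ?_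
  calc min (p x * q y) (p y * q x)
      ≤ Real.sqrt (p x * q y * (p y * q x)) :=
        min_le_sqrt_mul (mul_nonneg (hp x) (hq y)) (mul_nonneg (hp y) (hq x))
    _ = Real.sqrt (p x * q x * (p y * q y)) := by ring_nf
    _ = Real.sqrt (p x * q x) * Real.sqrt (p y * q y) :=
        Real.sqrt_mul (mul_nonneg (hp x) (hq x)) _

/-- `min a b = (a + b − |a − b|)/2`. [folklore] (private helper; the same one-liner exists elsewhere in the tree) -/
private theorem min_eq_half_sub_abs (a b : ℝ) : min a b = (a + b - |a - b|) / 2 := by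
  rcases le_total a b with h | h
  · rw [min_eq_left h, abs_of_nonpos (sub_nonpos.2 h)]; ring
  · rw [min_eq_right h, abs_of_nonneg (sub_nonneg.2 h)]; ring

/-- `max a b = (a + b + |a − b|)/2`. [folklore] (private helper; the same one-liner exists elsewhere in the tree) -/
private theorem max_eq_half_add_abs (a b : ℝ) : max a b = (a + b + |a - b|) / 2 := by
  rcases le_total a b with h | h
  · rw [max_eq_right h, abs_of_nonpos (sub_nonpos.2 h)]; ring
  · rw [max_eq_left h, abs_of_nonneg (sub_nonneg.2 h)]; ring

/-- `Σ min(p, q) = 1 − ‖p − q‖_TV` for probability vectors. [folklore] -/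
theorem sum_min_eq_one_sub_tvDist {p q : X → ℝ} (hp1 : ∑ x, p x = 1) (hq1 : ∑ x, q x = 1) :
    ∑ x, min (p x) (q x) = 1 - tvDist p q := by
  simp_rw [min_eq_half_sub_abs]
  rw [← Finset.sum_div, Finset.sum_sub_distrib, Finset.sum_add_distrib, hp1, hq1, tvDist]
  ring

/-- `Σ max(p, q) = 1 + ‖p − q‖_TV` for probability vectors. [folklore] -/
theorem sum_max_eq_one_add_tvDist {p q : X → ℝ} (hp1 : ∑ x, p x = 1) (hq1 : ∑ x, q x = 1) :
    ∑ x, max (p x) (q x) = 1 + tvDist p q := by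
  simp_rw [max_eq_half_add_abs]
  rw [← Finset.sum_div, Finset.sum_add_distrib, Finset.sum_add_distrib, hp1, hq1, tvDist]
  ring

/-- **Le Cam (proved):** `BC(p,q)² ≤ 1 − TV(p,q)²` — Cauchy–Schwarz on `√(pq) = √min · √max`
with `Σ min = 1 − TV`, `Σ max = 1 + TV`. [folklore] -/
theorem bhatt_sq_le {p q : X → ℝ} (hp : ∀ x, 0 ≤ p x) (hq : ∀ x, 0 ≤ q x)
    (hp1 : ∑ x, p x = 1) (hq1 : ∑ x, q x = 1) :
    bhatt p q ^ 2 ≤ 1 - tvDist p q ^ 2 := by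
  have hmn : ∀ x, 0 ≤ min (p x) (q x) := fun x => le_min (hp x) (hq x)
  have hmx : ∀ x, 0 ≤ max (p x) (q x) := fun x => le_trans (hp x) (le_max_left _ _)
  have hrepr : bhatt p q = ∑ x, Real.sqrt (min (p x) (q x)) * Real.sqrt (max (p x) (q x)) := by
    unfold bhatt
    refine Finset.sum_congr rfl fun x _ => ?_
    rw [← Real.sqrt_mul (hmn x), min_mul_max]
  rw [hrepr]
  calc (∑ x, Real.sqrt (min (p x) (q x)) * Real.sqrt (max (p x) (q x))) ^ 2
      ≤ (∑ x, Real.sqrt (min (p x) (q x)) ^ 2) * ∑ x, Real.sqrt (max (p x) (q x)) ^ 2 :=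
        Finset.sum_mul_sq_le_sq_mul_sq _ _ _
    _ = (∑ x, min (p x) (q x)) * ∑ x, max (p x) (q x) := by
        simp_rw [Real.sq_sqrt (hmn _), Real.sq_sqrt (hmx _)]
    _ = 1 - tvDist p q ^ 2 := by
        rw [sum_min_eq_one_sub_tvDist hp1 hq1, sum_max_eq_one_add_tvDist hp1 hq1]; ring

/-- Hence `acc ≤ 1 − TV²` as well as (T2-E) `acc ≤ 1 − TV`. -/
theorem accRate_le_one_sub_tvDist_sq {p q : X → ℝ} (hp : ∀ x, 0 ≤ p x) (hq : ∀ x, 0 ≤ q x)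
    (hp1 : ∑ x, p x = 1) (hq1 : ∑ x, q x = 1) :
    accRate p q ≤ 1 - tvDist p q ^ 2 :=
  (accRate_le_bhatt_sq hp hq).trans (bhatt_sq_le hp hq hp1 hq1)

end AccV12

section AccBlocks

variable {Z : Type*} [Fintype Z] {m : ℕ}

/-- `√(∏ fᵢ) = ∏ √fᵢ` for non-negative factors. [folklore] -/
theorem sqrt_prod {ι : Type*} (s : Finset ι) (f : ι → ℝ) (hf : ∀ i, 0 ≤ f i) :
    Real.sqrt (∏ i ∈ s, f i) = ∏ i ∈ s, Real.sqrt (f i) := by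
  classical
  induction s using Finset.induction_on with
  | empty => simp
  | insert a s ha ih => rw [Finset.prod_insert ha, Finset.prod_insert ha, Real.sqrt_mul (hf a), ih]

/-- **Tensorisation of the Bhattacharyya coefficient (proved):** `BC(⊗pᵢ, ⊗qᵢ) = ∏ BC(pᵢ,qᵢ)`.
[folklore] -/
theorem bhatt_blockProd {pb qb : Fin m → Z → ℝ} (hp : ∀ i z, 0 ≤ pb i z) (hq : ∀ i z, 0 ≤ qb i z) :
    bhatt (blockProd pb) (blockProd qb) = ∏ i, bhatt (pb i) (qb i) := by
  unfold bhatt blockProd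
  have : ∀ φ : Fin m → Z, Real.sqrt ((∏ i, pb i (φ i)) * ∏ i, qb i (φ i))
      = ∏ i, Real.sqrt (pb i (φ i) * qb i (φ i)) := by
    intro φ
    rw [← Finset.prod_mul_distrib, sqrt_prod _ _ (fun i => mul_nonneg (hp i _) (hq i _))]
  simp_rw [this]
  exact (Fintype.prod_sum (fun i z => Real.sqrt (pb i z * qb i z))).symm

/-- **T2-M′ (acceptance volume law, factorised regime; proved).**  If target and model both
factorise over `m` blocks and every block carries a total-variation defect `≥ δ`, the
independence-sampler acceptance obeys `acc ≤ ∏ BC(pᵢ,qᵢ)² ≤ (1 − δ²)^m ≤ e^{−m δ²}` —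
EXPONENTIALLY small in the number of blocks (volume at fixed block size).  Companion of the
ESS law `ESS ≤ e^{−2mδ²}` (T2-I + T2-A) and the finite shadow of the printed
`P_acc = erfc(√(σ²/8))`, `σ² ∝ V`. [folklore] -/
theorem acc_blockDefect_volume_law {pb qb : Fin m → Z → ℝ} (hp : ∀ i z, 0 ≤ pb i z)
    (hq : ∀ i z, 0 ≤ qb i z) (hp1 : ∀ i, ∑ z, pb i z = 1) (hq1 : ∀ i, ∑ z, qb i z = 1)
    {δ : ℝ} (hδ : 0 ≤ δ) (hdef : ∀ i, δ ≤ tvDist (pb i) (qb i)) :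
    accRate (blockProd pb) (blockProd qb) ≤ Real.exp (-((m : ℝ) * δ ^ 2)) := by
  have hP : ∀ φ, 0 ≤ blockProd pb φ := fun φ => Finset.prod_nonneg fun i _ => hp i _
  have hQ : ∀ φ, 0 ≤ blockProd qb φ := fun φ => Finset.prod_nonneg fun i _ => hq i _
  calc accRate (blockProd pb) (blockProd qb)
      ≤ bhatt (blockProd pb) (blockProd qb) ^ 2 := accRate_le_bhatt_sq hP hQ
    _ = ∏ i, bhatt (pb i) (qb i) ^ 2 := by rw [bhatt_blockProd hp hq, Finset.prod_pow]
    _ ≤ ∏ _i : Fin m, Real.exp (-δ ^ 2) := by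
        refine Finset.prod_le_prod (fun i _ => sq_nonneg _) fun i _ => ?_
        calc bhatt (pb i) (qb i) ^ 2 ≤ 1 - tvDist (pb i) (qb i) ^ 2 :=
              bhatt_sq_le (hp i) (hq i) (hp1 i) (hq1 i)
          _ ≤ 1 - δ ^ 2 := by
              have := pow_le_pow_left₀ hδ (hdef i) 2
              linarith
          _ ≤ Real.exp (-δ ^ 2) := by
              have := Real.add_one_le_exp (-δ ^ 2); linarith
    _ = Real.exp (-((m : ℝ) * δ ^ 2)) := by
        rw [Finset.prod_const, Finset.card_univ, Fintype.card_fin, ← Real.exp_nat_mul]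
        ring_nf

end AccBlocks

/-- **T2-M′ packaged (typed verbatim for the barrier entry; proved below).** [folklore] -/
def AccBlockDefectVolumeLaw : Prop :=
  ∀ (m : ℕ) (Z : Type) [Fintype Z] (pb qb : Fin m → Z → ℝ),
    (∀ i z, 0 ≤ pb i z) → (∀ i z, 0 ≤ qb i z) → (∀ i, ∑ z, pb i z = 1) → (∀ i, ∑ z, qb i z = 1) →
    ∀ δ : ℝ, 0 ≤ δ → (∀ i, δ ≤ tvDist (pb i) (qb i)) →
      accRate (blockProd pb) (blockProd qb) ≤ Real.exp (-((m : ℝ) * δ ^ 2))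

/-- T2-M′ holds (`acc_blockDefect_volume_law`). [folklore] -/
theorem accBlockDefectVolumeLaw : AccBlockDefectVolumeLaw :=
  fun _ _ _ _ _ hp hq hp1 hq1 _ hδ hdef => acc_blockDefect_volume_law hp hq hp1 hq1 hδ hdef

end Summit.Ventures.LatticeQCDFlow.Theory2
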